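import Mathlib.Analysis.Matrix.Spectrum
import Mathlib.Analysis.InnerProductSpace.PiL2
import Mathlib.LinearAlgebra.Matrix.PosDef
import Mathlib.LinearAlgebra.Matrix.Trace
import Literature.LinearAlgebra.Matrix.PerronSymmetric
import Literature.Analysis.Matrix.KyFanMaximumPrinciple
import Literature.Computation.Certificates.SemidefiniteRigorousBounds
import HarnessLib

/-!
# Jansson's rigorous SDP lower bound with the negative-eigenvalue count, and certificates of infeasibility

Topic `Literature/Computation/Certificates` (companion of `SemidefiniteRigorousBounds.lean`, which
formalises Jansson–Chaykin–Keil [JanssonChaykinKeil2008] Lemma 3.1 / Thm 3.2 / Thm 4.1 for exact data).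
This file adds the two SDP statements of

* C. Jansson, *Guaranteed accuracy for conic programming problems in vector lattices*,
  arXiv:0707.4366 (2007) [Jansson2007] — §6 "Semidefinite Programming", **Corollary 6.1**, and §8
  "Certificates of Infeasibility", **Propositions 8.1 and 8.2** with their SDP specialisations
  (held text `paper:arxiv-0707.4366`, pages p0013 (Cor. 6.1 with proof) and p0015 (§8)),

that are NOT consequences-as-stated of the Jansson–Chaykin–Keil file: there Lemma 3.1 / Thm 3.2 carry
the penalty `s · d⁻ · x̄` with `s` the DIMENSION of the block, while Corollary 6.1 sharpens `s` to the
NUMBER `l` OF NEGATIVE EIGENVALUES of the dual slack matrix `D` (for an almost dual-feasible `ỹ`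
typically `l ≪ s`), and §8 (theorems of alternatives, easy direction) is not treated there at all.

The standard primal SDP of [Jansson2007, (6.1)–(6.3)] is `f̂_p = min ⟨C, X⟩ s.t. ⟨A_i, X⟩ = b_i
(i = 1..m), X ⪰ 0` with `⟨C, X⟩ = trace (Cᵀ X)` over real symmetric `s × s` matrices, and its dual
(6.5) is `f̂_d = max bᵀy s.t. C − Σ_i y_i A_i ⪰ 0`.  Verbatim:

> **Corollary 6.1.** Assume that the SDP satisfies: (i) Either the primal problem is infeasible, or
> (ii) there exists a nonnegative number `x̄` such that for every `ε > 0` there exists a primal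
> feasible solution `X(ε) ≤ x̄ · I` and `⟨C, X(ε)⟩ − f̂_p ≤ ε`, where `I` denotes the identity matrix.
> Let `ỹ ∈ ℝ^m`, and let `D = C − Σ_{i=1}^m ỹ_i A_i`.  Suppose further that `d⁻ ≤ {λ_min(D), 0}`, and
> that `D` has at most `l` negative eigenvalues. Then:
> (a) The primal optimal value is bounded from below by `f̂_p ≥ bᵀỹ + l · d⁻ · x̄ =: f_p`.
> (b) If `d⁻ = 0` then `ỹ` is dual feasible and `f̂_d ≥ f_p = bᵀỹ`, and if moreover `ỹ` is optimal
> then `f̂_d = f_p`.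
>
> **Proposition 8.1.** Suppose that `ỹ ∈ Y*` satisfies `A*ỹ ∈ K*`, `⟨ỹ, b⟩ < 0`, then the system of
> primal constraints `Ax = b, x ∈ K` has no solution.  […] for SDP we get
> `bᵀỹ < 0 and λ_min(Σ_{i=1}^m ỹ_i A_i) ≥ 0`.
>
> **Proposition 8.2.** Suppose that `x̃ ∈ X` satisfies `Ax̃ = 0, x̃ ∈ K, ⟨c, x̃⟩ < 0` then the system
> of dual constraints `−A*y + c ∈ K*, y ∈ Y*` has no solution.

## Main statements (namespace `Literature.Computation.Certificates.Jansson2007`)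

All matrices are real; `D.IsHermitian` over `ℝ` means `D` symmetric; `hD.eigenvalues : n → ℝ` is
Mathlib's spectrum of `D` (with multiplicity), so "`d⁻ ≤ λ_min(D)`" is `∀ i, d⁻ ≤ hD.eigenvalues i` and
"`D` has at most `l` negative eigenvalues" is `#{i | hD.eigenvalues i < 0} ≤ l`; `X ≤ x̄ · I` (Löwner
order) is `(x̄ • 1 − X).PosSemidef`, as in `SemidefiniteRigorousBounds.lean`.

* `trace_mul_ge_of_negEigenvalues_le` — the engine of the proof of Cor. 6.1 (its display
  `⟨D⁻, X̄⟩`-estimate, i.e. [Jansson2007, Thm 4.3 (a)] specialised to the SDP cone): for symmetric `D`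
  with `d⁻ ≤ min(λ_min(D), 0)` and at most `l` negative eigenvalues and `0 ⪯ X ⪯ x̄ · 1`,
  `⟨D, X⟩ ≥ l · d⁻ · x̄`.  (With `l = s` this is [JanssonChaykinKeil2008, Lemma 3.1] =
  `JanssonChaykinKeil.lemma_3_1`.)
* `corollary_6_1a_feasible` — **Cor. 6.1 (a)** read pointwise: every primal feasible `X ⪯ x̄ · 1`
  satisfies `⟨C, X⟩ ≥ bᵀỹ + l · d⁻ · x̄`; `corollary_6_1a` — **Cor. 6.1 (a)** for the optimal value
  `f̂_p` under the primal boundedness qualification (ii) (alternative (i), primal infeasible, means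
  `f̂_p = +∞` [Jansson2007, after (3.1)] and has no content for a real `f̂_p`).
* `posSemidef_of_eigenvalues_nonneg'` / `corollary_6_1b` — **Cor. 6.1 (b)**: if `d⁻ = 0` (all
  eigenvalues of `D` nonnegative) then `D ⪰ 0`, i.e. `ỹ` is dual feasible, and `bᵀỹ ≤ ⟨C, X⟩` for
  every primal feasible `X` (so `bᵀỹ ≤ f̂_p`; and `bᵀỹ ≤ f̂_d` is the definition of a supremum).
* `proposition_8_1` — **Prop. 8.1, SDP form** [Jansson2007, §8, display after (8.6)]:
  `Σ_i ỹ_i A_i ⪰ 0` and `bᵀỹ < 0` ⟹ no `X ⪰ 0` with `⟨A_i, X⟩ = b_i`.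
* `proposition_8_2` — **Prop. 8.2, SDP form**: `X̃ ⪰ 0`, `⟨A_i, X̃⟩ = 0 (∀ i)`, `⟨C, X̃⟩ < 0` ⟹ no
  `y` with `C − Σ_i y_i A_i ⪰ 0`.
* `eigenvalues_ge_of_posSemidef_sub_smul` — the hypothesis bridge `D − d · 1 ⪰ 0 ⟹ d ≤ λ_i(D) ∀ i`
  (so the verified Cholesky enclosures of `CholeskyResidualEigenvalueBounds.lean`, which output the
  shifted-PSD shape, feed Cor. 6.1 as well).

No definitions, no named facts; everything stated is proved.  Inner products are written
`trace (M * X)` (for symmetric `M` this is `⟨M, X⟩ = trace (Mᵀ X)`).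

## References

* [Jansson2007] C. Jansson, *Guaranteed accuracy for conic programming problems in vector lattices*,
  arXiv:0707.4366 (2007), §6 Cor. 6.1, §8 Props. 8.1–8.2 (held text, p. 13 and p. 15).
* [JanssonChaykinKeil2008] C. Jansson, D. Chaykin, C. Keil, SIAM J. Numer. Anal. 46(1) (2007/08)
  180–200, doi:10.1137/050622870 — the `l = s` case (Lemma 3.1, Thm 3.2), in the tree as
  `Literature.Computation.Certificates.SemidefiniteRigorousBounds`.
* [HornJohnson2013] R. A. Horn, C. R. Johnson, *Matrix Analysis*, 2nd ed., Thm 4.1.5 (spectral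
  theorem; used through `Literature.Analysis.Matrix.KyFanMaximumPrinciple` and
  `Literature.LinearAlgebra.Matrix.PerronSymmetric`).
-/

namespace Literature.Computation.Certificates.Jansson2007

open Matrix Finset
open scoped BigOperators

variable {n : Type*} [Fintype n] [DecidableEq n] {μ : Type*} [Fintype μ]

/-! ### Eigen-coordinates: Rayleigh quotients at the eigenvectors -/

section Eigen

/-- The Rayleigh quotient of a symmetric `D` at its `i`-th unit eigenvector is `λ_i`:
`u_iᵀ D u_i = λ_i`. [cite: Jansson2007, §6 proof of Cor. 6.1 (eigenvalue decomposition `D = Qᵀ Λ Q`)] -/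
theorem eigenvector_dotProduct_mulVec {D : Matrix n n ℝ} (hD : D.IsHermitian) (i : n) :
    (hD.eigenvectorBasis i).ofLp ⬝ᵥ (D *ᵥ (hD.eigenvectorBasis i).ofLp) = hD.eigenvalues i := by
  rw [Literature.Analysis.Matrix.KyFan.dotProduct_mulVec_eq_sum_eigen hD]
  simp_rw [Literature.Analysis.Matrix.KyFan.eigenvectorBasis_dotProduct hD]
  simp [Finset.sum_ite_eq', apply_ite]

/-- The unit eigenvectors have `u_iᵀ u_i = 1`. [cite: Jansson2007, §6 proof of Cor. 6.1
(orthogonal `Q`)] -/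
theorem eigenvector_dotProduct_self {D : Matrix n n ℝ} (hD : D.IsHermitian) (i : n) :
    (hD.eigenvectorBasis i).ofLp ⬝ᵥ (hD.eigenvectorBasis i).ofLp = 1 := by
  rw [Literature.Analysis.Matrix.KyFan.eigenvectorBasis_dotProduct hD]
  simp

/-- **Hypothesis bridge.** `D − d · 1 ⪰ 0` (the output shape of a verified Cholesky / eigenvalue
enclosure) gives `d ≤ λ_i(D)` for every eigenvalue, i.e. `d ≤ λ_min(D)`.
[cite: Jansson2007, §6 (rigorous lower bound of the smallest eigenvalue, after Cor. 6.1)] -/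
theorem eigenvalues_ge_of_posSemidef_sub_smul {D : Matrix n n ℝ} (hD : D.IsHermitian) {d : ℝ}
    (h : (D - d • (1 : Matrix n n ℝ)).PosSemidef) (i : n) : d ≤ hD.eigenvalues i := by
  have h0 := h.dotProduct_mulVec_nonneg (hD.eigenvectorBasis i).ofLp
  rw [star_trivial, Matrix.sub_mulVec, dotProduct_sub, Matrix.smul_mulVec, Matrix.one_mulVec,
    dotProduct_smul, eigenvector_dotProduct_mulVec hD, eigenvector_dotProduct_self hD, smul_eq_mul,
    mul_one] at h0
  linarith

/-- A symmetric matrix with nonnegative eigenvalues is positive semidefinite (the reading of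
"`d⁻ = 0` then `ỹ` is dual feasible" in Cor. 6.1 (b)). [cite: Jansson2007, Cor. 6.1 (b)] -/
theorem posSemidef_of_eigenvalues_nonneg' {D : Matrix n n ℝ} (hD : D.IsHermitian) (h : ∀ i, 0 ≤ hD.eigenvalues i) : D.PosSemidef :=
  hD.posSemidef_iff_eigenvalues_nonneg.mpr h

/-- `u_iᵀ X u_i ≥ 0` for `X ⪰ 0` (plumbing). [folklore] -/
private theorem rayleigh_nonneg {D : Matrix n n ℝ} (hD : D.IsHermitian) {X : Matrix n n ℝ} (hX : X.PosSemidef) (i : n) :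
    0 ≤ (hD.eigenvectorBasis i).ofLp ⬝ᵥ (X *ᵥ (hD.eigenvectorBasis i).ofLp) := by
  have h := hX.dotProduct_mulVec_nonneg (hD.eigenvectorBasis i).ofLp
  rwa [star_trivial] at h

/-- `u_iᵀ X u_i ≤ x̄` for `X ⪯ x̄ · 1` (plumbing). [folklore] -/
private theorem rayleigh_le {D : Matrix n n ℝ} (hD : D.IsHermitian) {X : Matrix n n ℝ} {xub : ℝ}
    (hXub : (xub • (1 : Matrix n n ℝ) - X).PosSemidef) (i : n) :
    (hD.eigenvectorBasis i).ofLp ⬝ᵥ (X *ᵥ (hD.eigenvectorBasis i).ofLp) ≤ xub := by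
  have h0 := hXub.dotProduct_mulVec_nonneg (hD.eigenvectorBasis i).ofLp
  rw [star_trivial, Matrix.sub_mulVec, dotProduct_sub, Matrix.smul_mulVec, Matrix.one_mulVec,
    dotProduct_smul, eigenvector_dotProduct_self hD, smul_eq_mul, mul_one] at h0
  linarith

/-- **`⟨D, X⟩` in eigen-coordinates**: `trace (D X) = Σ_i λ_i · u_iᵀ X u_i`.
[cite: Jansson2007, §6 proof of Cor. 6.1 (`D = Qᵀ Λ Q`)] -/
theorem trace_mul_eq_sum_eigenvalues_mul_rayleigh {D : Matrix n n ℝ} (hD : D.IsHermitian) (X : Matrix n n ℝ) :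
    trace (D * X) = ∑ i, hD.eigenvalues i *
      ((hD.eigenvectorBasis i).ofLp ⬝ᵥ (X *ᵥ (hD.eigenvectorBasis i).ofLp)) := by
  have h := Literature.LinearAlgebra.Matrix.trace_mul_pow_eq_sum hD X 1
  simp only [pow_one] at h
  rw [Matrix.trace_mul_comm, h]
  refine sum_congr rfl fun i _ => ?_
  rw [Literature.LinearAlgebra.Matrix.star_eigU_mul_mul_eigU_apply hD X i, mul_comm]

end Eigen

/-! ### The engine: `⟨D, X⟩ ≥ l · d⁻ · x̄` -/

section Engine

variable {D X : Matrix n n ℝ}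

/-- **[Jansson2007, proof of Cor. 6.1]** (Thm 4.3 (a) for the SDP cone).  Let `D` be symmetric with
`d⁻ ≤ λ_min(D)`, `d⁻ ≤ 0`, and at most `l` negative eigenvalues, and let `0 ⪯ X ⪯ x̄ · 1` with
`0 ≤ x̄`.  Then `⟨D, X⟩ ≥ l · d⁻ · x̄`.  (In eigen-coordinates `⟨D, X⟩ = Σ λ_i q_i` with
`0 ≤ q_i = u_iᵀXu_i ≤ x̄`; drop the terms with `λ_i ≥ 0` and bound each of the at most `l` negative
ones by `d⁻ x̄`.) [cite: Jansson2007, Cor. 6.1 (a) and its proof] -/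
theorem trace_mul_ge_of_negEigenvalues_le (hD : D.IsHermitian) {dm xub : ℝ} {l : ℕ}
    (hd : ∀ i, dm ≤ hD.eigenvalues i) (hd0 : dm ≤ 0)
    (hl : (univ.filter fun i => hD.eigenvalues i < 0).card ≤ l)
    (hX : X.PosSemidef) (hXub : (xub • (1 : Matrix n n ℝ) - X).PosSemidef) (hxub : 0 ≤ xub) :
    (l : ℝ) * dm * xub ≤ trace (D * X) := by
  set q : n → ℝ := fun i => (hD.eigenvectorBasis i).ofLp ⬝ᵥ (X *ᵥ (hD.eigenvectorBasis i).ofLp)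
    with hq
  have hq0 : ∀ i, 0 ≤ q i := fun i => rayleigh_nonneg hD hX i
  have hq1 : ∀ i, q i ≤ xub := fun i => rayleigh_le hD hXub i
  have key : trace (D * X) = ∑ i, hD.eigenvalues i * q i :=
    trace_mul_eq_sum_eigenvalues_mul_rayleigh hD X
  rw [key]
  set N := univ.filter fun i => hD.eigenvalues i < 0 with hN
  have hdx : dm * xub ≤ 0 := mul_nonpos_of_nonpos_of_nonneg hd0 hxub
  calc (l : ℝ) * dm * xub = (l : ℝ) * (dm * xub) := by ring
    _ ≤ (N.card : ℝ) * (dm * xub) := by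
        have hcl : (N.card : ℝ) ≤ l := by exact_mod_cast hl
        exact mul_le_mul_of_nonpos_right hcl hdx
    _ = ∑ _i ∈ N, dm * xub := by rw [sum_const, nsmul_eq_mul]
    _ ≤ ∑ i ∈ N, hD.eigenvalues i * q i := by
        refine sum_le_sum fun i hi => ?_
        have hneg : hD.eigenvalues i < 0 := (mem_filter.mp hi).2
        calc dm * xub ≤ hD.eigenvalues i * xub := mul_le_mul_of_nonneg_right (hd i) hxub
          _ ≤ hD.eigenvalues i * q i := mul_le_mul_of_nonpos_left (hq1 i) hneg.le
    _ ≤ ∑ i, hD.eigenvalues i * q i := by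
        refine sum_le_sum_of_subset_of_nonneg (filter_subset _ _) fun i _ hi => ?_
        have hnn : ¬ hD.eigenvalues i < 0 := fun h => hi (mem_filter.mpr ⟨mem_univ _, h⟩)
        exact mul_nonneg (not_lt.mp hnn) (hq0 i)

/-- The same engine with the hypothesis `d⁻ ≤ λ_min(D)` in the shifted-PSD shape `D − d⁻ · 1 ⪰ 0`.
[cite: Jansson2007, Cor. 6.1 (a) and its proof] -/
theorem trace_mul_ge_of_negEigenvalues_le' (hD : D.IsHermitian) {dm xub : ℝ} {l : ℕ}
    (hd : (D - dm • (1 : Matrix n n ℝ)).PosSemidef) (hd0 : dm ≤ 0)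
    (hl : (univ.filter fun i => hD.eigenvalues i < 0).card ≤ l)
    (hX : X.PosSemidef) (hXub : (xub • (1 : Matrix n n ℝ) - X).PosSemidef) (hxub : 0 ≤ xub) :
    (l : ℝ) * dm * xub ≤ trace (D * X) :=
  trace_mul_ge_of_negEigenvalues_le hD (eigenvalues_ge_of_posSemidef_sub_smul hD hd) hd0 hl hX hXub
    hxub

end Engine

/-! ### Corollary 6.1 -/

section SDP

variable (C : Matrix n n ℝ) (A : μ → Matrix n n ℝ) (b : μ → ℝ) (y : μ → ℝ)

omit [DecidableEq n] in
/-- Splitting the objective along an arbitrary `ỹ`: `⟨C, X⟩ = ⟨C − Σ_i ỹ_i A_i, X⟩ + bᵀỹ` for every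
`X` satisfying the equality constraints. [cite: Jansson2007, proof of Thm 4.1 (a)
(`⟨c, x⟩ = ⟨−A*ỹ + c, x⟩ + ⟨ỹ, b⟩`)] -/
theorem objective_eq {X : Matrix n n ℝ} (hAX : ∀ i, trace (A i * X) = b i) :
    trace (C * X) = trace ((C - ∑ i, y i • A i) * X) + ∑ i, b i * y i := by
  rw [sub_mul, Matrix.trace_sub, Finset.sum_mul, Matrix.trace_sum]
  simp only [Matrix.smul_mul, Matrix.trace_smul, smul_eq_mul, hAX]
  have : ∑ i, y i * b i = ∑ i, b i * y i := sum_congr rfl fun i _ => mul_comm _ _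
  rw [this]; ring

/-- **[Jansson2007, Corollary 6.1 (a)], pointwise.**  Let `ỹ ∈ ℝ^m`, `D = C − Σ_i ỹ_i A_i`,
`d⁻ ≤ min(λ_min(D), 0)`, `D` with at most `l` negative eigenvalues.  Then every primal feasible `X`
(`X ⪰ 0`, `⟨A_i, X⟩ = b_i`) with `X ⪯ x̄ · 1`, `x̄ ≥ 0`, satisfies `⟨C, X⟩ ≥ bᵀỹ + l · d⁻ · x̄`.
[cite: Jansson2007, Cor. 6.1 (a)] -/
theorem corollary_6_1a_feasible {dm xub : ℝ} {l : ℕ} (hD : (C - ∑ i, y i • A i).IsHermitian)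
    (hd : ∀ i, dm ≤ hD.eigenvalues i) (hd0 : dm ≤ 0)
    (hl : (univ.filter fun i => hD.eigenvalues i < 0).card ≤ l)
    {X : Matrix n n ℝ} (hX : X.PosSemidef) (hXub : (xub • (1 : Matrix n n ℝ) - X).PosSemidef)
    (hxub : 0 ≤ xub) (hAX : ∀ i, trace (A i * X) = b i) :
    ∑ i, b i * y i + l * dm * xub ≤ trace (C * X) := by
  rw [objective_eq C A b y hAX]
  have h := trace_mul_ge_of_negEigenvalues_le hD hd hd0 hl hX hXub hxub
  linarith

/-- **[Jansson2007, Corollary 6.1 (a)]** for the primal optimal value `f̂_p` under the primal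
boundedness qualification (ii): if for every `ε > 0` some primal feasible `X(ε) ⪯ x̄ · 1` has
`⟨C, X(ε)⟩ − f̂_p ≤ ε`, then `f̂_p ≥ bᵀỹ + l · d⁻ · x̄ =: f_p`.  (Alternative (i) of the corollary —
the primal problem is infeasible — means `f̂_p = +∞` by the convention after [Jansson2007, (3.1)],
and the bound is then trivially true; it has no content for a real number `f̂_p`.)
[cite: Jansson2007, Cor. 6.1 (a)] -/
theorem corollary_6_1a {dm xub fp : ℝ} {l : ℕ} (hD : (C - ∑ i, y i • A i).IsHermitian)
    (hd : ∀ i, dm ≤ hD.eigenvalues i) (hd0 : dm ≤ 0)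
    (hl : (univ.filter fun i => hD.eigenvalues i < 0).card ≤ l) (hxub : 0 ≤ xub)
    (hPBQ : ∀ ε > 0, ∃ X : Matrix n n ℝ, X.PosSemidef ∧ (xub • (1 : Matrix n n ℝ) - X).PosSemidef ∧
      (∀ i, trace (A i * X) = b i) ∧ trace (C * X) - fp ≤ ε) :
    ∑ i, b i * y i + l * dm * xub ≤ fp := by
  refine le_of_forall_pos_le_add fun ε hε => ?_
  obtain ⟨X, hX, hXub, hAX, hgap⟩ := hPBQ ε hε
  have h := corollary_6_1a_feasible C A b y hD hd hd0 hl hX hXub hxub hAX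
  linarith

/-- **[Jansson2007, Corollary 6.1 (b)].**  If `d⁻ = 0`, i.e. all eigenvalues of
`D = C − Σ_i ỹ_i A_i` are nonnegative, then `ỹ` is dual feasible (`D ⪰ 0`) and weak duality gives
`bᵀỹ ≤ ⟨C, X⟩` for EVERY primal feasible `X` — no boundedness qualification needed — hence
`f_p = bᵀỹ ≤ f̂_p`; that also `bᵀỹ ≤ f̂_d` is the definition of the dual optimal value as a supremum
over dual feasible points. [cite: Jansson2007, Cor. 6.1 (b)] -/
theorem corollary_6_1b (hD : (C - ∑ i, y i • A i).IsHermitian) (hd : ∀ i, 0 ≤ hD.eigenvalues i)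
    {X : Matrix n n ℝ} (hX : X.PosSemidef) (hAX : ∀ i, trace (A i * X) = b i) :
    (C - ∑ i, y i • A i).PosSemidef ∧ ∑ i, b i * y i ≤ trace (C * X) := by
  have hDpsd : (C - ∑ i, y i • A i).PosSemidef := posSemidef_of_eigenvalues_nonneg' hD hd
  refine ⟨hDpsd, ?_⟩
  rw [objective_eq C A b y hAX]
  have h := trace_mul_nonneg_of_posSemidef hDpsd hX
  linarith

/-! ### §8: certificates of infeasibility (SDP form) -/

omit [DecidableEq n] in
/-- **[Jansson2007, Proposition 8.1], SDP form** (display for SDP at the end of §8): if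
`Σ_i ỹ_i A_i ⪰ 0` (`λ_min(Σ ỹ_i A_i) ≥ 0`) and `bᵀỹ < 0`, then the primal constraints
`⟨A_i, X⟩ = b_i, X ⪰ 0` have no solution (`ỹ` is a certificate of primal infeasibility, a dual
unbounded ray).  *Proof.* `0 ≤ ⟨Σ ỹ_i A_i, X⟩ = Σ ỹ_i b_i < 0`. [cite: Jansson2007, Prop. 8.1] -/
theorem proposition_8_1 (hy : (∑ i, y i • A i).PosSemidef) (hb : ∑ i, b i * y i < 0) :
    ¬ ∃ X : Matrix n n ℝ, X.PosSemidef ∧ ∀ i, trace (A i * X) = b i := by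
  rintro ⟨X, hX, hAX⟩
  have h := trace_mul_nonneg_of_posSemidef hy hX
  rw [Finset.sum_mul, Matrix.trace_sum] at h
  simp only [Matrix.smul_mul, Matrix.trace_smul, smul_eq_mul, hAX] at h
  have : ∑ i, y i * b i = ∑ i, b i * y i := sum_congr rfl fun i _ => mul_comm _ _
  linarith

omit [DecidableEq n] in
/-- **[Jansson2007, Proposition 8.2], SDP form**: if `X̃ ⪰ 0`, `⟨A_i, X̃⟩ = 0` for all `i` and
`⟨C, X̃⟩ < 0`, then the dual constraints `C − Σ_i y_i A_i ⪰ 0` have no solution (`X̃` is a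
certificate of dual infeasibility, a primal unbounded ray).  *Proof.*
`0 ≤ ⟨C − Σ y_i A_i, X̃⟩ = ⟨C, X̃⟩ < 0`. [cite: Jansson2007, Prop. 8.2] -/
theorem proposition_8_2 {Xr : Matrix n n ℝ} (hXr : Xr.PosSemidef) (hA0 : ∀ i, trace (A i * Xr) = 0)
    (hC : trace (C * Xr) < 0) :
    ¬ ∃ y : μ → ℝ, (C - ∑ i, y i • A i).PosSemidef := by
  rintro ⟨y', hy'⟩
  have h := trace_mul_nonneg_of_posSemidef hy' hXr
  rw [sub_mul, Matrix.trace_sub, Finset.sum_mul, Matrix.trace_sum] at h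
  simp only [Matrix.smul_mul, Matrix.trace_smul, smul_eq_mul, hA0, mul_zero, sum_const_zero,
    sub_zero] at h
  linarith

end SDP

end Literature.Computation.Certificates.Jansson2007
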